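import Mathlib.Analysis.InnerProductSpace.PiL2
import Mathlib.Tactic

/-!
# The `(p 0, p 1)`-coordinate near `V∞` is consistent across the cap charts `ηV` and `ηC`
(registered helper `helper_wedgeCoordinateConsistentV` of line `cross-cap-laurent`, crux
`GromovRecognitionRelEnd`, item stmt-SmoothPoincare4-11009)

The wedge cap `X` of a 4-manifold `M` carries three polydisc cap charts
`ηH : {|(p 2, p 3)| < R₁⁻¹} → X`, `ηV : {|(p 0, p 1)| < R₁⁻¹} → X` and `ηC : {both} → X`
(coordinates `p 0, p 1` = first complex factor, `p 2, p 3` = second factor), glued to `ι ∘ χ` by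
complex inversion of one factor off the corresponding axis, with `ηC = ηV ∘ inv₂` off
`(p 2, p 3) = 0` and `ηC = ηH ∘ inv₁` off `(p 0, p 1) = 0`, where
`inv₂ p = (p 0, p 1, (p 2, -p 3) / (p 2 ^ 2 + p 3 ^ 2))` keeps the coordinates `0, 1`.  The sphere
at infinity `V∞` is `{(p 0, p 1) = 0}` in both `ηV` and `ηC`.  This file proves the purely
logical fact that the `(p 0, p 1)`-coordinates read through `ηV` and through `ηC` agree wherever
the two chart images overlap, so that `T_V = p 0 + i p 1` is ONE coordinate near `V∞`: if
`ηV p = ηC p'` then either `p'` is off the second axis, the gluing clause rewrites `ηC p' = ηV q`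
with `q 0 = p' 0`, `q 1 = p' 1` and injectivity of `ηV` on its polydisc gives `p = q`; or `p'` is
on the second axis, and then `ηC p'` is an `H`-axis point or the corner `ηC 0`, neither of which
is in `range ι`, forcing `p` onto the `V`-axis as well — which the disjointness of the two axis
images rules out unless `p' = 0`, where both coordinate pairs vanish.  (Mirror of
`helper_wedgeCoordinateConsistent`, with the roles of the two factors swapped.)
-/

-- the prescribed namespace `Summit.<P>.<Sub>.…` duplicates `SmoothPoincare4` (P = Sub)
set_option linter.dupNamespace false

namespace Summit.SmoothPoincare4.SmoothPoincare4.Theorems.GromovRecognitionRelEnd.CrossCapLaurent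

/-- **The `(p 0, p 1)`-coordinate is consistent across the `ηV`/`ηC` cap charts.**  Given
injectivity of `ηV` on the `V`-polydisc, the gluing clause of `ηV` with `ι ∘ χ` off the `V`-axis,
the fact that `H`-axis points `ηH {q 2 = q 3 = 0}` and the corner `ηC 0` are not in `range ι`,
the two gluing clauses `ηC = ηH ∘ inv₁` (off `(p 0, p 1) = 0`) and `ηC = ηV ∘ inv₂`
(off `(p 2, p 3) = 0`), and disjointness of the `H`-axis image from the `V`-axis image, any
coincidence `ηV p = ηC p'` of chart values (with `p`, `p'` in the respective polydiscs) forces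
`p 0 = p' 0` and `p 1 = p' 1`. -/
theorem helper_wedgeCoordinateConsistentV : ∀ (M : Type) (X : Type) (R₁ : ℝ) (χ : EuclideanSpace ℝ (Fin 4) → M) (ι : M → X) (ηH ηV ηC : EuclideanSpace ℝ (Fin 4) → X), Set.InjOn ηV {p : EuclideanSpace ℝ (Fin 4) | p 0 ^ 2 + p 1 ^ 2 < R₁⁻¹ ^ 2} → (∀ p : EuclideanSpace ℝ (Fin 4), p 0 ^ 2 + p 1 ^ 2 < R₁⁻¹ ^ 2 → (p 0 ≠ 0 ∨ p 1 ≠ 0) → ηV p = ι (χ (WithLp.toLp 2 ![p 0 / (p 0 ^ 2 + p 1 ^ 2), -(p 1) / (p 0 ^ 2 + p 1 ^ 2), p 2, p 3]))) → (∀ p : EuclideanSpace ℝ (Fin 4), p 2 = 0 → p 3 = 0 → ηH p ∉ Set.range ι) → (∀ p : EuclideanSpace ℝ (Fin 4), p 0 ^ 2 + p 1 ^ 2 < R₁⁻¹ ^ 2 → p 2 ^ 2 + p 3 ^ 2 < R₁⁻¹ ^ 2 → (p 0 ≠ 0 ∨ p 1 ≠ 0) → ηC p = ηH (WithLp.toLp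 2 ![p 0 / (p 0 ^ 2 + p 1 ^ 2), -(p 1) / (p 0 ^ 2 + p 1 ^ 2), p 2, p 3])) → (∀ p : EuclideanSpace ℝ (Fin 4), p 0 ^ 2 + p 1 ^ 2 < R₁⁻¹ ^ 2 → p 2 ^ 2 + p 3 ^ 2 < R₁⁻¹ ^ 2 → (p 2 ≠ 0 ∨ p 3 ≠ 0) → ηC p = ηV (WithLp.toLp 2 ![p 0, p 1, p 2 / (p 2 ^ 2 + p 3 ^ 2), -(p 3) / (p 2 ^ 2 + p 3 ^ 2)])) → ηC 0 ∉ Set.range ι → (∀ p q : EuclideanSpace ℝ (Fin 4), p 2 = 0 → p 3 = 0 → q 0 = 0 → q 1 = 0 → ηH p ≠ ηV q) → ∀ p p' : EuclideanSpace ℝ (Fin 4), p 0 ^ 2 + p 1 ^ 2 < R₁⁻¹ ^ 2 → p' 0 ^ 2 + p' 1 ^ 2 < R₁⁻¹ ^ 2 → p' 2 ^ 2 + p' 3 ^ 2 < R₁⁻¹ ^ 2 → ηV p = ηC p' → p 0 = p' 0 ∧ p 1 = p' 1 := by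
  intro M X R₁ χ ι ηH ηV ηC hinj hV hHaxis hCH hCV hC0 hdisj p p' hp hp'₁ hp'₂ heq
  by_cases h23 : p' 2 ≠ 0 ∨ p' 3 ≠ 0
  · -- `p'` off the second axis: invert the second factor, `ηC p' = ηV q` with `q 0 = p' 0`,
    -- `q 1 = p' 1`, and `ηV` is injective on its polydisc
    have hq := hCV p' hp'₁ hp'₂ h23
    have hq0 : (WithLp.toLp 2 ![p' 0, p' 1, p' 2 / (p' 2 ^ 2 + p' 3 ^ 2),
        -(p' 3) / (p' 2 ^ 2 + p' 3 ^ 2)] : EuclideanSpace ℝ (Fin 4)) 0 = p' 0 := by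
      simp
    have hq1 : (WithLp.toLp 2 ![p' 0, p' 1, p' 2 / (p' 2 ^ 2 + p' 3 ^ 2),
        -(p' 3) / (p' 2 ^ 2 + p' 3 ^ 2)] : EuclideanSpace ℝ (Fin 4)) 1 = p' 1 := by
      simp
    have hmem : (WithLp.toLp 2 ![p' 0, p' 1, p' 2 / (p' 2 ^ 2 + p' 3 ^ 2),
        -(p' 3) / (p' 2 ^ 2 + p' 3 ^ 2)] : EuclideanSpace ℝ (Fin 4)) ∈
        {p : EuclideanSpace ℝ (Fin 4) | p 0 ^ 2 + p 1 ^ 2 < R₁⁻¹ ^ 2} := by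
      rw [Set.mem_setOf_eq, hq0, hq1]
      exact hp'₁
    have hpq := hinj hp hmem (heq.trans hq)
    rw [hpq, hq0, hq1]
    exact ⟨rfl, rfl⟩
  · -- `p'` on the second axis
    push Not at h23
    by_cases h01 : p' 0 ≠ 0 ∨ p' 1 ≠ 0
    · -- invert the first factor: `ηC p' = ηH q` with `q` an `H`-axis point, not in `range ι`
      have hq := hCH p' hp'₁ hp'₂ h01
      have hq2 : (WithLp.toLp 2 ![p' 0 / (p' 0 ^ 2 + p' 1 ^ 2), -(p' 1) / (p' 0 ^ 2 + p' 1 ^ 2),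
          p' 2, p' 3] : EuclideanSpace ℝ (Fin 4)) 2 = 0 := by
        simp [h23.1]
      have hq3 : (WithLp.toLp 2 ![p' 0 / (p' 0 ^ 2 + p' 1 ^ 2), -(p' 1) / (p' 0 ^ 2 + p' 1 ^ 2),
          p' 2, p' 3] : EuclideanSpace ℝ (Fin 4)) 3 = 0 := by
        simp [h23.2]
      have hnot := hHaxis _ hq2 hq3
      exfalso
      by_cases hp01 : p 0 ≠ 0 ∨ p 1 ≠ 0
      · -- `p` off the `V`-axis: `ηV p ∈ range ι`, contradiction
        refine hnot ?_
        rw [← hq, ← heq]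
        exact ⟨_, (hV p hp hp01).symm⟩
      · -- `p` on the `V`-axis: an `H`-axis point equals a `V`-axis point, contradiction
        push Not at hp01
        exact hdisj _ p hq2 hq3 hp01.1 hp01.2 (heq.trans hq).symm
    · -- all four coordinates of `p'` vanish: `p' = 0`, `ηV p = ηC 0 ∉ range ι`
      push Not at h01
      have hp0 : p' = 0 := by
        ext i
        fin_cases i
        · simpa using h01.1
        · simpa using h01.2
        · simpa using h23.1
        · simpa using h23.2
      by_cases hp01 : p 0 ≠ 0 ∨ p 1 ≠ 0
      · -- `p` off the `V`-axis: `ηV p ∈ range ι`, contradiction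
        exfalso
        refine hC0 ?_
        rw [← hp0, ← heq]
        exact ⟨_, (hV p hp hp01).symm⟩
      · -- `p` on the `V`-axis as well: both coordinate pairs vanish
        push Not at hp01
        exact ⟨hp01.1.trans h01.1.symm, hp01.2.trans h01.2.symm⟩

end Summit.SmoothPoincare4.SmoothPoincare4.Theorems.GromovRecognitionRelEnd.CrossCapLaurent
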